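import Mathlib
import Literature.NumberTheory.LFunctions.Zhang2022.Section16U041LData
import Literature.NumberTheory.LFunctions.Zhang2022.Section15CU055Residue
import Literature.NumberTheory.LFunctions.Zhang2022.TypedSection16BLemma162Rp
import HarnessLib

/-!
# The residue at the triple pole `s = 0` of the repaired §16 integrand
# `ζ(1+s)²ζ(1+s−βⱼ)L(1+s,χ)L(1+s−βⱼ,χ)²·E₂ⱼ(1+s)·Tˢω₁(s)/s` is `L′(1,χ)³E₂ⱼ(1) + O((1+|L′|)³𝓛⁻⁴)`
# (Zhang (2022) §16 p. 94, tex L4662–L4664, "the contour of integration is moved in the same way as in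
# the proof of Lemma 8.4 … = L′(1,χ)³𝔲₂ⱼ(1) + O(1/𝓛⁴)", repaired normaliser of row G-d57-1; ZHANG-L WP16
# block C, node `Typed.Section16B.Step16_u041aR`, input `Typed.Section16B.Lemma162Rq`)

Topic `Literature/NumberTheory/LFunctions/Zhang2022` (Landau–Siegel audit tree; verdict-neutral).
Y. Zhang, *Discrete mean estimates and the Landau–Siegel zero*, arXiv:2211.02515v1 (2022)
[Zhang2022LandauSiegel] — **an unrefereed manuscript under adjudication**; nothing here asserts or denies
its Theorems 1–2. No display of the manuscript is asserted here either: this file proves, FROM the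
repaired Lemma 16.2 with explicit bounds (`Typed.Section16B.Lemma162Rq c′`, taken as a hypothesis BY NAME —
WP16 block D proves `lemma162Rq_holds`), the size of the residue at `s = 0` of
`Typed.Section16B.integrand16_u040R` in the pole-datum format of the lane's contour engine
(`GaussKernelContour.norm_lineIntegral_sub_residues_le`: `Res₀ = ((swap dslope 0)^[2] φ₀)(0)` with
`φ₀(z) = ζ₁(1+z)²·(M(z)·E₂ⱼ(1+z))·Tᶻω₁(z)`, `M(z) = ζ(1+z−βⱼ)L(1+z,χ)L(1+z−βⱼ,χ)²`):

* `norm_res0_sub_main_le (c') (hRq)` — there is `C ≥ 0` with, for all large `D`, under (A), `j ∈ {1,2}`: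
  `‖((swap dslope 0)^[2] φ₀)(0) − L′(1,χ)³·E₂ⱼ(1)‖ ≤ C(1+‖L′(1,χ)‖)³𝓛⁻⁴`.

Ingredients (all tree theorems): `U055.residue_triple_eq` (`Res₀ = ½φ₀″(0)`),
`U055.norm_residue_triple_sub_le_of_analyticAt` (Leibniz + Cauchy, radii decoupled: `M` analytic at `0`,
`V = E₂ⱼ(1+·)` holomorphic and `≤ C𝓛` on `|z| < 1/𝓛`), `U041.resFactor_bounds` (`‖M(0)‖ ≤ Cα⁴(1+ℓ)²`,
`‖M′(0)‖ ≤ Cα(1+ℓ)³`, `‖½M″(0) − L′³‖ ≤ Cα𝓛³(1+ℓ)³`), and the near-one clause (v) of `Lemma162Rq`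
(`Typed.Section16B.frakU2R_near_one_bound_of_lemma162Rq_inv`). Arithmetic: `α𝓛⁴ = π𝓛⁻⁵`,
`log T = 𝓛^{1.1} ≤ 𝓛²`. WHAT THIS IS NOT: the contour shift itself (block C part (C2)), the residue at the
simple pole `s = βⱼ` (part (C4)), or the closer of `Step16_u041aR`.

## References
* Y. Zhang, arXiv:2211.02515v1 (2022), §16 p. 94, tex L4655–L4665; §8 proof of Lemma 8.4.
  [cite: Zhang2022LandauSiegel, §16 p.94]
* J. B. Conway, *Functions of One Complex Variable I*, GTM 11, Ch. V Prop. 2.4. [cite: Conway1978, Ch. V Prop. 2.4]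
-/

noncomputable section

open Complex Real Set Filter Topology Metric

namespace Literature.NumberTheory.LFunctions.Zhang2022.U041

open Literature.NumberTheory.LFunctions.Zhang2022.Skeleton
open Literature.NumberTheory.LFunctions.Zhang2022.Typed.Section16B
open GaussWeight

/-! ### Real bookkeeping -/

/-- Real bookkeeping for the residue at `0`: with `X₀ = C_Mα⁴(1+ℓ)²`, `X₁ = C_Mα(1+ℓ)³`,
`X₂ = C_Mα𝓛³(1+ℓ)³`, `S = C_E𝓛`, `r = 1/𝓛`, `log Y ≤ 𝓛²`, `α𝓛⁹ = π`, the right-hand side of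
`U055.norm_residue_triple_sub_le_of_analyticAt` is `≤ 4(5K+11)C_MC_E(1+ℓ)³𝓛⁻⁴`. [folklore] -/
private theorem bookkeeping_res0 {α L K CM CE ℓ lY : ℝ} (hα : 0 < α) (hL : 2 ≤ L) (hK : 0 ≤ K)
    (hCM : 0 ≤ CM) (hCE : 0 ≤ CE) (hℓ : 0 ≤ ℓ) (hlY0 : 0 ≤ lY) (hlY : lY ≤ L ^ 2)
    (hαL : α * L ^ 9 = π) :
    CM * α * L ^ 3 * (1 + ℓ) ^ 3 * (CE * L) +
          CM * α * (1 + ℓ) ^ 3 * (2 * (CE * L) / (1 / L)) +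
          CM * α ^ 4 * (1 + ℓ) ^ 2 * (4 * (CE * L) / (1 / L) ^ 2) +
        (K + lY) * (CM * α * (1 + ℓ) ^ 3 * (CE * L) + CM * α ^ 4 * (1 + ℓ) ^ 2 * (2 * (CE * L) / (1 / L))) +
        (K + K * lY + lY ^ 2 / 2) * (CM * α ^ 4 * (1 + ℓ) ^ 2 * (CE * L)) ≤
      4 * (5 * K + 11) * CM * CE * (1 + ℓ) ^ 3 * (L ^ 4)⁻¹ := by
  have hL1 : 1 ≤ L := by linarith
  have hL0 : 0 < L := by linarith
  have h1ℓ : (1 : ℝ) ≤ 1 + ℓ := by linarith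
  -- `α ≤ 1` and `α³L⁵ ≤ 1`
  have hα1 : α ≤ 1 := by
    have h9 : (4 : ℝ) ≤ L ^ 9 := by
      calc (4 : ℝ) ≤ 2 ^ 9 := by norm_num
        _ ≤ L ^ 9 := pow_le_pow_left₀ (by norm_num) hL 9
    have h := mul_le_mul_of_nonneg_left h9 hα.le
    rw [hαL] at h
    nlinarith [Real.pi_lt_d2]
  have hα3L5 : α ^ 3 * L ^ 5 ≤ 1 := by
    -- `α³L⁵ = π³/L²²`
    have e : α ^ 3 * L ^ 5 * L ^ 22 = (α * L ^ 9) ^ 3 := by ring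
    have h22 : (32 : ℝ) ≤ L ^ 22 := by
      calc (32 : ℝ) = 2 ^ 5 := by norm_num
        _ ≤ L ^ 5 := pow_le_pow_left₀ (by norm_num) hL 5
        _ ≤ L ^ 22 := pow_le_pow_right₀ hL1 (by norm_num)
    have hπ3 : (α * L ^ 9) ^ 3 ≤ 32 := by
      rw [hαL]
      have h := pow_le_pow_left₀ Real.pi_pos.le Real.pi_lt_d2.le 3
      have : (3.15 : ℝ) ^ 3 ≤ 32 := by norm_num
      linarith
    have e' : α ^ 3 * L ^ 5 = (α * L ^ 9) ^ 3 / L ^ 22 := by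
      rw [eq_div_iff (by positivity), e]
    calc α ^ 3 * L ^ 5 = (α * L ^ 9) ^ 3 / L ^ 22 := e'
      _ ≤ 32 / L ^ 22 := by gcongr
      _ ≤ 1 := by rw [div_le_one (by positivity)]; exact h22
  -- the unit `U = CM·CE·α·L⁴·(1+ℓ)³`
  set U : ℝ := CM * CE * α * L ^ 4 * (1 + ℓ) ^ 3 with hU
  have hU0 : 0 ≤ U := by positivity
  have hp23 : (1 + ℓ) ^ 2 ≤ (1 + ℓ) ^ 3 := pow_le_pow_right₀ h1ℓ (by norm_num)
  have hL34 : L ^ 3 ≤ L ^ 4 := pow_le_pow_right₀ hL1 (by norm_num)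
  have hL24 : L ^ 2 ≤ L ^ 4 := pow_le_pow_right₀ hL1 (by norm_num)
  have hα4 : α ^ 4 ≤ α := by
    calc α ^ 4 = α * α ^ 3 := by ring
      _ ≤ α * 1 := by gcongr; exact pow_le_one₀ hα.le hα1
      _ = α := mul_one _
  have hKlY : K + lY ≤ (K + 1) * L ^ 2 := by
    have : (1 : ℝ) ≤ L ^ 2 := one_le_pow₀ hL1
    nlinarith
  have hKlY2 : K + K * lY + lY ^ 2 / 2 ≤ (2 * K + 1) * L ^ 4 := by
    have h4 : lY ^ 2 ≤ (L ^ 2) ^ 2 := pow_le_pow_left₀ hlY0 hlY 2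
    have : (1 : ℝ) ≤ L ^ 4 := one_le_pow₀ hL1
    nlinarith
  -- the pieces against `U`
  have hL12 : (1 : ℝ) ≤ L ^ 2 := one_le_pow₀ hL1
  have t1 : CM * α * L ^ 3 * (1 + ℓ) ^ 3 * (CE * L) = U := by simp only [hU]; ring
  have t2 : CM * α * (1 + ℓ) ^ 3 * (2 * (CE * L) / (1 / L)) ≤ 2 * U := by
    have e : CM * α * (1 + ℓ) ^ 3 * (2 * (CE * L) / (1 / L)) = 2 * (CM * CE * α * L ^ 2 * (1 + ℓ) ^ 3) := by
      field_simp
    rw [e, hU]; gcongr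
  have t3 : CM * α ^ 4 * (1 + ℓ) ^ 2 * (4 * (CE * L) / (1 / L) ^ 2) ≤ 4 * U := by
    have e : CM * α ^ 4 * (1 + ℓ) ^ 2 * (4 * (CE * L) / (1 / L) ^ 2) =
        4 * (CM * CE * α ^ 4 * L ^ 3 * (1 + ℓ) ^ 2) := by
      field_simp
    rw [e, hU]; gcongr
  have t4a : (K + lY) * (CM * α * (1 + ℓ) ^ 3 * (CE * L)) ≤ (K + 1) * U := by
    calc (K + lY) * (CM * α * (1 + ℓ) ^ 3 * (CE * L))
        ≤ ((K + 1) * L ^ 2) * (CM * α * (1 + ℓ) ^ 3 * (CE * L)) :=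
          mul_le_mul_of_nonneg_right hKlY (by positivity)
      _ = (K + 1) * (CM * CE * α * L ^ 3 * (1 + ℓ) ^ 3) := by ring
      _ ≤ (K + 1) * U := by rw [hU]; gcongr
  have t4b : (K + lY) * (CM * α ^ 4 * (1 + ℓ) ^ 2 * (2 * (CE * L) / (1 / L))) ≤ 2 * (K + 1) * U := by
    have e : CM * α ^ 4 * (1 + ℓ) ^ 2 * (2 * (CE * L) / (1 / L)) =
        2 * (CM * CE * α ^ 4 * L ^ 2 * (1 + ℓ) ^ 2) := by
      field_simp
    rw [e]
    calc (K + lY) * (2 * (CM * CE * α ^ 4 * L ^ 2 * (1 + ℓ) ^ 2))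
        ≤ ((K + 1) * L ^ 2) * (2 * (CM * CE * α ^ 4 * L ^ 2 * (1 + ℓ) ^ 2)) :=
          mul_le_mul_of_nonneg_right hKlY (by positivity)
      _ = 2 * (K + 1) * (CM * CE * α ^ 4 * L ^ 4 * (1 + ℓ) ^ 2) := by ring
      _ ≤ 2 * (K + 1) * U := by rw [hU]; gcongr
  have t5 : (K + K * lY + lY ^ 2 / 2) * (CM * α ^ 4 * (1 + ℓ) ^ 2 * (CE * L)) ≤ (2 * K + 1) * U := by
    have hα4L5 : α ^ 4 * L ^ 5 ≤ α * L ^ 4 := by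
      have : α ^ 4 * L ^ 5 = (α * L ^ 4) * (α ^ 3 * L ^ 5) / L ^ 4 := by field_simp
      rw [this, div_le_iff₀ (by positivity)]
      have h4 : (1 : ℝ) ≤ L ^ 4 := one_le_pow₀ hL1
      have h0 : 0 ≤ α * L ^ 4 := by positivity
      calc α * L ^ 4 * (α ^ 3 * L ^ 5) ≤ α * L ^ 4 * 1 := by gcongr
        _ ≤ α * L ^ 4 * L ^ 4 := by gcongr
    calc (K + K * lY + lY ^ 2 / 2) * (CM * α ^ 4 * (1 + ℓ) ^ 2 * (CE * L))
        ≤ ((2 * K + 1) * L ^ 4) * (CM * α ^ 4 * (1 + ℓ) ^ 2 * (CE * L)) :=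
          mul_le_mul_of_nonneg_right hKlY2 (by positivity)
      _ = (2 * K + 1) * (CM * CE * (1 + ℓ) ^ 2) * (α ^ 4 * L ^ 5) := by ring
      _ ≤ (2 * K + 1) * (CM * CE * (1 + ℓ) ^ 2) * (α * L ^ 4) := by gcongr
      _ = (2 * K + 1) * (CM * CE * α * L ^ 4 * (1 + ℓ) ^ 2) := by ring
      _ ≤ (2 * K + 1) * U := by rw [hU]; gcongr
  -- `U ≤ 4·CM·CE·(1+ℓ)³/L⁴` (`αL⁴ = π/L⁵ ≤ 4/L⁴`)
  have hU4 : U ≤ 4 * (CM * CE * (1 + ℓ) ^ 3 * (L ^ 4)⁻¹) := by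
    have hαL4 : α * L ^ 4 ≤ 4 * (L ^ 4)⁻¹ := by
      have e : α * L ^ 4 = π / L ^ 5 := by
        rw [← hαL]; field_simp
      rw [e, div_le_iff₀ (by positivity)]
      have e2 : 4 * (L ^ 4)⁻¹ * L ^ 5 = 4 * L := by field_simp
      rw [e2]
      nlinarith [Real.pi_lt_d2]
    calc U = (CM * CE * (1 + ℓ) ^ 3) * (α * L ^ 4) := by simp only [hU]; ring
      _ ≤ (CM * CE * (1 + ℓ) ^ 3) * (4 * (L ^ 4)⁻¹) := by gcongr
      _ = 4 * (CM * CE * (1 + ℓ) ^ 3 * (L ^ 4)⁻¹) := by ring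
  have hsplit : (K + lY) * (CM * α * (1 + ℓ) ^ 3 * (CE * L) +
      CM * α ^ 4 * (1 + ℓ) ^ 2 * (2 * (CE * L) / (1 / L))) =
      (K + lY) * (CM * α * (1 + ℓ) ^ 3 * (CE * L)) +
        (K + lY) * (CM * α ^ 4 * (1 + ℓ) ^ 2 * (2 * (CE * L) / (1 / L))) := by ring
  rw [hsplit, t1]
  have htot : U + 2 * U + 4 * U + ((K + 1) * U + 2 * (K + 1) * U) + (2 * K + 1) * U = (5 * K + 11) * U := by
    ring
  calc U + CM * α * (1 + ℓ) ^ 3 * (2 * (CE * L) / (1 / L)) +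
        CM * α ^ 4 * (1 + ℓ) ^ 2 * (4 * (CE * L) / (1 / L) ^ 2) +
        ((K + lY) * (CM * α * (1 + ℓ) ^ 3 * (CE * L)) +
          (K + lY) * (CM * α ^ 4 * (1 + ℓ) ^ 2 * (2 * (CE * L) / (1 / L)))) +
        (K + K * lY + lY ^ 2 / 2) * (CM * α ^ 4 * (1 + ℓ) ^ 2 * (CE * L))
      ≤ U + 2 * U + 4 * U + ((K + 1) * U + 2 * (K + 1) * U) + (2 * K + 1) * U := by
        gcongr
    _ = (5 * K + 11) * U := htot
    _ ≤ (5 * K + 11) * (4 * (CM * CE * (1 + ℓ) ^ 3 * (L ^ 4)⁻¹)) := by gcongr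
    _ = 4 * (5 * K + 11) * CM * CE * (1 + ℓ) ^ 3 * (L ^ 4)⁻¹ := by ring

/-! ### The residue at `0`, pointwise in `D` -/

/-- `ℓ^{1.1} ≤ ℓ²` for `ℓ ≥ 1`. [folklore] -/
private theorem rpow_oneone_le_sq {ℓ : ℝ} (hℓ : 1 ≤ ℓ) : ℓ ^ (1.1 : ℝ) ≤ ℓ ^ 2 := by
  have := Real.rpow_le_rpow_of_exponent_le hℓ (by norm_num : (1.1 : ℝ) ≤ 2)
  rwa [show ((2 : ℝ)) = ((2 : ℕ) : ℝ) by norm_num, Real.rpow_natCast] at this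

/-- `M ≤ 𝓛` once `D ≥ ⌈e^M⌉`. [cite: Zhang2022LandauSiegel, §2 (2.1)] -/
private theorem le_ell_of_ceil_exp_le₁₇ {M : ℝ} {D : ℕ} (hD : ⌈Real.exp M⌉₊ ≤ D) : M ≤ ell D := by
  have h : Real.exp M ≤ D := le_trans (Nat.le_ceil _) (by exact_mod_cast hD)
  exact (Real.le_log_iff_exp_le (lt_of_lt_of_le (Real.exp_pos _) h)).mpr h

/-- **The residue at `0`, pointwise**: given the size lemma (constant `K`), the `M`-data (constant `C_M`)
and the near-one data of `E` (constant `C_E`) at a modulus `D` with `𝓛 ≥ 10`, the residue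
`((swap dslope 0)^[2] φ₀)(0)` of `ζ(1+z)²·M(z)E(1+z)·Tᶻω₁(z)/z³`-type datum is
`L′(1,χ)³E(1) + O((5K+11)C_MC_E(1+ℓ)³𝓛⁻⁴)`. [cite: Zhang2022LandauSiegel, §16 p.94] -/
theorem norm_res0_sub_main_le_at {D : ℕ} [NeZero D] (χ : DirichletCharacter ℂ D) (β : ℂ) (E : ℂ → ℂ)
    {K CM CE : ℝ} (hK0 : 0 ≤ K) (hCM : 0 ≤ CM) (hCE : 0 ≤ CE) (hℓ10 : 10 ≤ ell D)
    (hres : ∀ (Λ Y r S : ℝ) (M V : ℂ → ℂ) (m : ℂ), 1 ≤ Λ → 1 ≤ Y → 0 < r →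
      AnalyticAt ℂ M 0 → DifferentiableOn ℂ V (ball 0 r) →
      (∀ z ∈ ball (0 : ℂ) r, ‖V z‖ ≤ S) →
      ‖iteratedDeriv 2 (fun z => riemannZeta₁ (1 + z) ^ 2 * (M z * V z) * ((Y : ℂ) ^ z * omega1 Λ z)) 0
            / 2 - m * V 0‖ ≤
        ‖iteratedDeriv 2 M 0 / 2 - m‖ * S + ‖deriv M 0‖ * (2 * S / r) + ‖M 0‖ * (4 * S / r ^ 2) +
          (K + Real.log Y) * (‖deriv M 0‖ * S + ‖M 0‖ * (2 * S / r)) +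
          (K + K * Real.log Y + Real.log Y ^ 2 / 2) * (‖M 0‖ * S))
    (hMan : AnalyticAt ℂ
      (fun z : ℂ => riemannZeta (1 + z - β) * χ.LFunction (1 + z) * χ.LFunction (1 + z - β) ^ 2) 0)
    (hM0 : ‖(fun z : ℂ => riemannZeta (1 + z - β) * χ.LFunction (1 + z) *
        χ.LFunction (1 + z - β) ^ 2) 0‖ ≤ CM * alpha D ^ 4 * (1 + ‖deriv χ.LFunction 1‖) ^ 2)
    (hM1 : ‖deriv (fun z : ℂ => riemannZeta (1 + z - β) * χ.LFunction (1 + z) *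
        χ.LFunction (1 + z - β) ^ 2) 0‖ ≤ CM * alpha D * (1 + ‖deriv χ.LFunction 1‖) ^ 3)
    (hM2 : ‖iteratedDeriv 2 (fun z : ℂ => riemannZeta (1 + z - β) * χ.LFunction (1 + z) *
        χ.LFunction (1 + z - β) ^ 2) 0 / 2 - deriv χ.LFunction 1 ^ 3‖ ≤
        CM * alpha D * ell D ^ 3 * (1 + ‖deriv χ.LFunction 1‖) ^ 3)
    (hEd : DifferentiableOn ℂ E {s : ℂ | 9 / 10 < s.re})
    (hEn : ∀ s : ℂ, ‖s - 1‖ ≤ (ell D)⁻¹ → ‖E s‖ ≤ CE * ell D) :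
    ‖(Function.swap dslope (0 : ℂ))^[2]
        (fun z : ℂ => riemannZeta₁ (1 + z) ^ 2 *
          ((riemannZeta (1 + z - β) * χ.LFunction (1 + z) * χ.LFunction (1 + z - β) ^ 2) * E (1 + z)) *
          (((bigT D : ℝ) : ℂ) ^ z * omega1 (ell D ^ 30) z)) 0 -
        deriv χ.LFunction 1 ^ 3 * E 1‖ ≤
      4 * (5 * K + 11) * CM * CE * (1 + ‖deriv χ.LFunction 1‖) ^ 3 * (ell D ^ 4)⁻¹ := by
  have hℓ1 : 1 ≤ ell D := by linarith
  have hℓ2 : 2 ≤ ell D := by linarith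
  have hℓ0 : 0 < ell D := by linarith
  -- parameters
  have hΛ : (1 : ℝ) ≤ ell D ^ 30 := one_le_pow₀ hℓ1
  have hY : (1 : ℝ) ≤ bigT D := by rw [bigT]; exact Real.one_le_exp (Real.rpow_nonneg hℓ0.le _)
  have hr : (0 : ℝ) < 1 / ell D := by positivity
  have hlogT : Real.log (bigT D) = ell D ^ (1.1 : ℝ) := log_bigT D
  have hlY0 : 0 ≤ Real.log (bigT D) := by rw [hlogT]; exact Real.rpow_nonneg hℓ0.le _
  have hlY : Real.log (bigT D) ≤ ell D ^ 2 := by rw [hlogT]; exact rpow_oneone_le_sq hℓ1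
  have hα : alpha D * ell D ^ 9 = π := by
    rw [alpha, bigP, Real.log_exp]; field_simp
  have hαpos : 0 < alpha D := by
    have : alpha D = π / ell D ^ 9 := by rw [alpha, bigP, Real.log_exp]
    rw [this]; positivity
  -- `V(z) = E(1+z)` on `|z| < 1/𝓛`
  set M : ℂ → ℂ := fun z : ℂ => riemannZeta (1 + z - β) * χ.LFunction (1 + z) *
    χ.LFunction (1 + z - β) ^ 2 with hMdef
  set V : ℂ → ℂ := fun z : ℂ => E (1 + z) with hVdef
  have hmaps : MapsTo (fun z : ℂ => 1 + z) (ball (0 : ℂ) (1 / ell D)) {s : ℂ | 9 / 10 < s.re} := by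
    intro z hz
    rw [mem_ball_zero_iff] at hz
    rw [Set.mem_setOf_eq, Complex.add_re, Complex.one_re]
    have h1 : |z.re| ≤ ‖z‖ := Complex.abs_re_le_norm z
    have h2 : 1 / ell D ≤ 1 / 10 := by
      rw [div_le_div_iff₀ hℓ0 (by norm_num)]; linarith
    have h3 : -z.re ≤ |z.re| := neg_le_abs _
    linarith
  have hVd : DifferentiableOn ℂ V (ball (0 : ℂ) (1 / ell D)) :=
    hEd.comp (((differentiable_const _).add differentiable_id).differentiableOn) hmaps
  have hVS : ∀ z ∈ ball (0 : ℂ) (1 / ell D), ‖V z‖ ≤ CE * ell D := by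
    intro z hz
    rw [mem_ball_zero_iff] at hz
    refine hEn (1 + z) ?_
    rw [add_sub_cancel_left, ← one_div]; exact hz.le
  -- the size lemma
  have h := hres (ell D ^ 30) (bigT D) (1 / ell D) (CE * ell D) M V (deriv χ.LFunction 1 ^ 3)
    hΛ hY hr hMan hVd hVS
  have hV0 : V 0 = E 1 := by simp [hVdef]
  rw [hV0] at h
  -- `Res₀ = ½φ₀″(0)`
  set φ : ℂ → ℂ := fun z => riemannZeta₁ (1 + z) ^ 2 * (M z * V z) *
    (((bigT D : ℝ) : ℂ) ^ z * omega1 (ell D ^ 30) z) with hφdef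
  have hφa : AnalyticAt ℂ φ 0 := by
    have hT0 : (0 : ℝ) < bigT D := lt_of_lt_of_le zero_lt_one hY
    have h1 : AnalyticAt ℂ (fun z : ℂ => riemannZeta₁ (1 + z) ^ 2) 0 :=
      ((differentiable_riemannZeta₁.comp ((differentiable_const _).add differentiable_id)).pow 2
        |>.analyticAt 0)
    have h2 : AnalyticAt ℂ V 0 := hVd.analyticAt (isOpen_ball.mem_nhds (mem_ball_self hr))
    have h3 : AnalyticAt ℂ (fun z : ℂ => ((bigT D : ℝ) : ℂ) ^ z * omega1 (ell D ^ 30) z) 0 := by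
      have hT0' : ((bigT D : ℝ) : ℂ) ≠ 0 := by exact_mod_cast hT0.ne'
      have hd1 : Differentiable ℂ (fun z : ℂ => ((bigT D : ℝ) : ℂ) ^ z) := fun z =>
        differentiableAt_id.const_cpow (Or.inl hT0')
      have hd : Differentiable ℂ (fun z : ℂ => ((bigT D : ℝ) : ℂ) ^ z * omega1 (ell D ^ 30) z) :=
        hd1.mul (U055.differentiable_omega1 _)
      exact hd.analyticAt 0
    exact (h1.mul (hMan.mul h2)).mul h3
  have hVn : {z : ℂ | AnalyticAt ℂ φ z} ∈ 𝓝 (0 : ℂ) := hφa.eventually_analyticAt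
  have hφd : DifferentiableOn ℂ φ {z : ℂ | AnalyticAt ℂ φ z} :=
    fun z hz => hz.differentiableAt.differentiableWithinAt
  have hres0 : (Function.swap dslope (0 : ℂ))^[2] φ 0 = iteratedDeriv 2 φ 0 / 2 :=
    U055.residue_triple_eq hVn hφd
  -- assemble (`set` has already rewritten the goal in terms of `φ`)
  rw [hres0]
  refine h.trans ?_
  have hbk := bookkeeping_res0 (K := K) (CM := CM) (CE := CE) (ℓ := ‖deriv χ.LFunction 1‖)
    (lY := Real.log (bigT D)) hαpos hℓ2 hK0 hCM hCE (norm_nonneg _) hlY0 hlY hα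
  refine le_trans ?_ hbk
  have hS0 : 0 ≤ CE * ell D := by positivity
  have hKY : 0 ≤ K + Real.log (bigT D) := by positivity
  have hKY2 : 0 ≤ K + K * Real.log (bigT D) + Real.log (bigT D) ^ 2 / 2 := by positivity
  gcongr

/-! ### The residue at `0`, for all large `D`, from `Lemma162Rq` -/

/-- **The residue at the triple pole `s = 0` of the repaired §16 integrand is `L′(1,χ)³E₂ⱼ(1) +
O((1+|L′(1,χ)|)³𝓛⁻⁴)`** — in the pole-datum format of `GaussKernelContour.norm_lineIntegral_sub_residues_le`
(`Res₀ = ((swap dslope 0)^[2] φ₀)(0)`, `φ₀(z) = ζ₁(1+z)²·(ζ(1+z−βⱼ)L(1+z,χ)L(1+z−βⱼ,χ)²·E₂ⱼ(1+z))·Tᶻω₁(z)`,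
`ω₁ = GaussWeight.omega1 (𝓛³⁰)`, `T = bigT D`, `E₂ⱼ = frakU2R c′ χ j`), from the repaired Lemma 16.2
with explicit bounds `Typed.Section16B.Lemma162Rq c′` (near-one clause (v): `‖E₂ⱼ(s)‖ ≤ C𝓛` on
`|s−1| ≤ 𝓛⁻¹`), for all large `D` under (A), `j ∈ {1,2}`. The step "… = L′(1,χ)³𝔲₂ⱼ(1) + O(1/𝓛⁴)" of
§16 p. 94 (tex L4662–L4664) at the repaired normaliser (row G-d57-1), residue part; ZHANG-L WP16 block C.
[cite: Zhang2022LandauSiegel, §16 p.94] -/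
theorem norm_res0_sub_main_le (c' : ℝ) (hRq : Lemma162Rq c') : ∃ C : ℝ, 0 ≤ C ∧
    ForAllLarge fun D _ χ => AssumptionA D χ → ∀ j ∈ ({1, 2} : Finset ℕ),
      ‖(Function.swap dslope (0 : ℂ))^[2]
          (fun z : ℂ => riemannZeta₁ (1 + z) ^ 2 *
            ((riemannZeta (1 + z - betaJ c' D j) * χ.LFunction (1 + z) *
                χ.LFunction (1 + z - betaJ c' D j) ^ 2) * frakU2R c' χ j (1 + z)) *
            (((bigT D : ℝ) : ℂ) ^ z * omega1 (ell D ^ 30) z)) 0 -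
          deriv χ.LFunction 1 ^ 3 * frakU2R c' χ j 1‖ ≤
        C * (1 + ‖deriv χ.LFunction 1‖) ^ 3 * (ell D ^ 4)⁻¹ := by
  obtain ⟨CM, hCM0, hM⟩ := resFactor_bounds c'
  obtain ⟨CE, hE⟩ := frakU2R_near_one_bound_of_lemma162Rq_inv c' hRq
  obtain ⟨K, hK0, hres⟩ := U055.norm_residue_triple_sub_le_of_analyticAt
  set CE' : ℝ := max CE 0 with hCE'
  have hCE'0 : 0 ≤ CE' := le_max_right _ _
  refine ⟨4 * (5 * K + 11) * CM * CE', by positivity, ?_⟩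
  have h10 : ForAllLarge fun D _ _ => (10 : ℝ) ≤ ell D :=
    ForAllLarge.of_le ⌈Real.exp 10⌉₊ fun D _ _ hD _ _ => le_ell_of_ceil_exp_le₁₇ hD
  refine ((hM.and hE).and h10).mono fun D _ χ _ _ hh hA j hj => ?_
  obtain ⟨⟨hM', hE'⟩, hℓ10⟩ := hh
  have hj3 : j ∈ ({1, 2, 3} : Finset ℕ) := by
    simp only [Finset.mem_insert, Finset.mem_singleton] at hj ⊢
    rcases hj with h | h
    · exact Or.inl h
    · exact Or.inr (Or.inl h)
  obtain ⟨hMan, hM0, hM1, hM2⟩ := hM' hA j hj3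
  obtain ⟨hEd, -, -, hEn, -⟩ := hE' hA j hj
  have hEn' : ∀ s : ℂ, ‖s - 1‖ ≤ (ell D)⁻¹ → ‖frakU2R c' χ j s‖ ≤ CE' * ell D := by
    intro s hs
    refine (hEn s hs).trans ?_
    have : 0 ≤ ell D := by linarith
    exact mul_le_mul_of_nonneg_right (le_max_left _ _) this
  exact norm_res0_sub_main_le_at χ (betaJ c' D j) (frakU2R c' χ j) hK0 hCM0 hCE'0 hℓ10 hres hMan
    hM0 hM1 hM2 hEd hEn'

end Literature.NumberTheory.LFunctions.Zhang2022.U041
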